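import Summits.Ventures.HodgeRepro.RectQuadKKThreshold

/-!
# The two-generator rectangle for every odd `k`: the ELEMENT form

Blind re-derivation cell `pub-hodge-repro`, seat `p1` (gen 11).  Gen 10 proved the fifth mechanism in the hom form
(`exists_rectQuad_kk`: an injective `ψ : ℤ/2 × ℤ/k × ℤ/k →* G` with `ψ(1,0,0) = c`) and its element form only at
`k = 3` (`exists_rectQuad33_of_elems`).  This file is the element form for EVERY odd `k ≥ 3`: commuting
`w₁, w₂ ∈ G` of order `k` that are INDEPENDENT (`w₁ᵃ w₂ᵇ = 1 ⇒ w₁ᵃ = 1`, i.e. `⟨w₁⟩ ∩ ⟨w₂⟩ = 1`) give, for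
`4k² ≤ |G|`, a CM type whose twists `Φ, Φ(cw₁), Φ(cw₂), Φ(w₁w₂)` are `SumTwo` without a conjugate pair
(`exists_rectQuad_kk_of_elems`), and — with `RectQuadKKThreshold.lean` — exactly when `4k² ≤ |G|`
(`exists_rectQuad_kk_of_elems_iff`).

The hom `(s, a, b) ↦ cˢ w₁ᵃ w₂ᵇ` (`rectHomKK`) is injective because `k` is odd: raising `cˢ w₁ᵃ w₂ᵇ = 1` to the
`k`-th power kills the odd-order part and leaves `cˢ = 1`, so `s = 0`; then independence and `orderOf = k` force
`a = b = 0`.  This is the form the abelian classification uses: for an abelian `(G, c)` the clause `(E_k)` reads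
«two elements of odd order `k` generating `C_k × C_k` and `4k² ≤ |G|`».
-/

set_option autoImplicit false

open Finset
open scoped Pointwise

namespace HodgeRepro.CosetQuad

variable {G : Type*} [Group G]

section Elems

variable (k : ℕ) [NeZero k]

/-- The hom `ℤ/2 × ℤ/k × ℤ/k →* G`, `(s, a, b) ↦ cˢ w₁ᵃ w₂ᵇ`, for a complex conjugation `c` and commuting
`w₁, w₂` of order `k`. -/
def rectHomKK {c : G} (hc : IsComplexConj c) {w₁ w₂ : G} (h1 : orderOf w₁ = k) (h2 : orderOf w₂ = k)
    (h12 : w₁ * w₂ = w₂ * w₁) : PKK k →* G :=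
  (zmodPowHom 2 c (conj_sq_eq_one hc)).noncommCoprod
    ((zmodPowHom k w₁ (by rw [← h1, pow_orderOf_eq_one])).noncommCoprod
      (zmodPowHom k w₂ (by rw [← h2, pow_orderOf_eq_one])) fun _ _ => Commute.pow_pow h12 _ _)
    fun _ _ => Commute.mul_right (Commute.pow_pow (hc.comm w₁) _ _) (Commute.pow_pow (hc.comm w₂) _ _)

/-- `rectHomKK (s, a, b) = cˢ w₁ᵃ w₂ᵇ`. -/
theorem rectHomKK_apply {c : G} (hc : IsComplexConj c) {w₁ w₂ : G} (h1 : orderOf w₁ = k)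
    (h2 : orderOf w₂ = k) (h12 : w₁ * w₂ = w₂ * w₁) (p : PKK k) :
    rectHomKK k hc h1 h2 h12 p = c ^ (Multiplicative.toAdd p.1).val *
      (w₁ ^ (Multiplicative.toAdd p.2.1).val * w₂ ^ (Multiplicative.toAdd p.2.2).val) := rfl

/-- `rectHomKK (1,0,0) = c`. -/
theorem rectHomKK_conj {c : G} (hc : IsComplexConj c) {w₁ w₂ : G} (h1 : orderOf w₁ = k)
    (h2 : orderOf w₂ = k) (h12 : w₁ * w₂ = w₂ * w₁) : rectHomKK k hc h1 h2 h12 (conjKK k) = c := by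
  rw [rectHomKK_apply]
  show c ^ (1 : ZMod 2).val * (w₁ ^ (0 : ZMod k).val * w₂ ^ (0 : ZMod k).val) = c
  simp only [ZMod.val_zero, val_one_two, pow_zero, pow_one, mul_one]

/-- `rectHomKK` is injective for `k` odd and independent `w₁, w₂`. -/
theorem rectHomKK_injective {c : G} (hc : IsComplexConj c) {w₁ w₂ : G} (h1 : orderOf w₁ = k)
    (h2 : orderOf w₂ = k) (h12 : w₁ * w₂ = w₂ * w₁) (hodd : Odd k)
    (hind : ∀ a b : ℕ, w₁ ^ a * w₂ ^ b = 1 → w₁ ^ a = 1) :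
    Function.Injective (rectHomKK k hc h1 h2 h12) := by
  rw [injective_iff_map_eq_one]
  rintro ⟨s, a, b⟩ hp
  rw [rectHomKK_apply] at hp
  dsimp only at hp
  have hs2 := ZMod.val_lt (Multiplicative.toAdd s)
  have hak := ZMod.val_lt (Multiplicative.toAdd a)
  have hbk := ZMod.val_lt (Multiplicative.toAdd b)
  set S := (Multiplicative.toAdd s).val with hS
  set A := (Multiplicative.toAdd a).val with hA
  set B := (Multiplicative.toAdd b).val with hB
  have hw1 : w₁ ^ k = 1 := by rw [← h1, pow_orderOf_eq_one]
  have hw2 : w₂ ^ k = 1 := by rw [← h2, pow_orderOf_eq_one]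
  have hcomm1 : Commute (c ^ S) (w₁ ^ A * w₂ ^ B) :=
    Commute.mul_right (Commute.pow_pow (hc.comm w₁) _ _) (Commute.pow_pow (hc.comm w₂) _ _)
  have hcomm2 : Commute (w₁ ^ A) (w₂ ^ B) := Commute.pow_pow h12 _ _
  -- the `k`-th power kills the odd part: `c ^ (S k) = 1`
  have hS0 : S = 0 := by
    have h : (c ^ S * (w₁ ^ A * w₂ ^ B)) ^ k = 1 := by rw [hp, one_pow]
    rw [hcomm1.mul_pow, hcomm2.mul_pow, ← pow_mul, ← pow_mul, ← pow_mul, mul_comm A k, pow_mul w₁ k A,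
      hw1, one_pow, mul_comm B k, pow_mul w₂ k B, hw2, one_pow, one_mul, mul_one] at h
    have hsv : S = 0 ∨ S = 1 := by omega
    rcases hsv with hs0 | hs1
    · exact hs0
    · exfalso
      rw [hs1, one_mul] at h
      -- `c ^ k = c` for `k` odd
      obtain ⟨m, hm⟩ := hodd
      rw [hm, pow_succ, pow_mul, conj_sq_eq_one hc, one_pow, one_mul] at h
      exact hc.ne_one h
  rw [hS0, pow_zero, one_mul] at hp
  have hA1 : w₁ ^ A = 1 := hind A B hp
  have hB1 : w₂ ^ B = 1 := by rw [hA1, one_mul] at hp; exact hp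
  have hA0 : A = 0 := by
    have := orderOf_dvd_of_pow_eq_one hA1
    rw [h1] at this
    rcases Nat.eq_zero_or_pos A with h0 | hpos
    · exact h0
    · exact absurd (Nat.le_of_dvd hpos this) (by omega)
  have hB0 : B = 0 := by
    have := orderOf_dvd_of_pow_eq_one hB1
    rw [h2] at this
    rcases Nat.eq_zero_or_pos B with h0 | hpos
    · exact h0
    · exact absurd (Nat.le_of_dvd hpos this) (by omega)
  have hs : s = 1 := by
    rw [← ofAdd_toAdd s, (ZMod.val_eq_zero _).1 hS0, ofAdd_zero]
  have ha : a = 1 := by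
    rw [← ofAdd_toAdd a, (ZMod.val_eq_zero _).1 hA0, ofAdd_zero]
  have hb : b = 1 := by
    rw [← ofAdd_toAdd b, (ZMod.val_eq_zero _).1 hB0, ofAdd_zero]
  rw [hs, ha, hb]
  rfl

omit [NeZero k] in
/-- `(1 : ℤ/k).val = 1` for `k ≥ 2`. -/
theorem val_one_k (hk : 2 ≤ k) : (1 : ZMod k).val = 1 := by
  rw [ZMod.val_one_eq_one_mod]
  exact Nat.mod_eq_of_lt (by omega)

/-- The quadruple `Φ, Φ(cw₁), Φ(cw₂), Φ(w₁w₂)`. -/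
def rectQuadKK (Φ : Finset G) (w₁ w₂ c : G) : Fin 4 → Finset G :=
  ![Φ, rmul Φ (c * w₁), rmul Φ (c * w₂), rmul Φ (w₁ * w₂)]

/-- `rectQuadKK Φ w₁ w₂ c` is the quadruple of twists by `rectHomKK (twistKK i)` (`k ≥ 2`). -/
theorem rectQuadKK_eq_twists (hk : 2 ≤ k) (Φ : Finset G) {c : G} (hc : IsComplexConj c)
    {w₁ w₂ : G} (h1 : orderOf w₁ = k) (h2 : orderOf w₂ = k) (h12 : w₁ * w₂ = w₂ * w₁) :
    rectQuadKK Φ w₁ w₂ c = fun i => rmul Φ (rectHomKK k hc h1 h2 h12 (twistKK k i)) := by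
  funext i
  rw [rectHomKK_apply]
  have hv1 := val_one_k k hk
  fin_cases i
  · show Φ = rmul Φ (c ^ (0 : ZMod 2).val * (w₁ ^ (0 : ZMod k).val * w₂ ^ (0 : ZMod k).val))
    simp only [ZMod.val_zero, pow_zero, one_mul, rmul_one]
  · show rmul Φ (c * w₁) = rmul Φ (c ^ (1 : ZMod 2).val * (w₁ ^ (1 : ZMod k).val * w₂ ^ (0 : ZMod k).val))
    simp only [ZMod.val_zero, val_one_two, hv1, pow_zero, pow_one, mul_one]
  · show rmul Φ (c * w₂) = rmul Φ (c ^ (1 : ZMod 2).val * (w₁ ^ (0 : ZMod k).val * w₂ ^ (1 : ZMod k).val))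
    simp only [ZMod.val_zero, val_one_two, hv1, pow_zero, pow_one, one_mul]
  · show rmul Φ (w₁ * w₂) =
      rmul Φ (c ^ (0 : ZMod 2).val * (w₁ ^ (1 : ZMod k).val * w₂ ^ (1 : ZMod k).val))
    simp only [ZMod.val_zero, hv1, pow_zero, pow_one, one_mul]

/-- **The two-generator rectangle, element form, every odd `k ≥ 3`.**  Commuting independent `w₁, w₂` of
order `k` and `4k² ≤ |G|` give a CM type whose twists `Φ, Φ(cw₁), Φ(cw₂), Φ(w₁w₂)` are `SumTwo` without a
conjugate pair. -/
theorem exists_rectQuad_kk_of_elems [Fintype G] [DecidableEq G] {c : G} (hc : IsComplexConj c) {w₁ w₂ : G}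
    (h1 : orderOf w₁ = k) (h2 : orderOf w₂ = k) (h12 : w₁ * w₂ = w₂ * w₁) (hk : 3 ≤ k) (hodd : Odd k)
    (hind : ∀ a b : ℕ, w₁ ^ a * w₂ ^ b = 1 → w₁ ^ a = 1) (hG : 4 * (k * k) ≤ Fintype.card G) :
    ∃ Φ : Finset G, IsCMType c Φ ∧ SumTwo (rectQuadKK Φ w₁ w₂ c) ∧
      ∀ i j : Fin 4, rectQuadKK Φ w₁ w₂ c j ≠ c • rectQuadKK Φ w₁ w₂ c i := by
  obtain ⟨Φ, hΦ, hs, hnc⟩ := exists_rectQuad_kk k (rectHomKK k hc h1 h2 h12)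
    (rectHomKK_injective k hc h1 h2 h12 hodd hind) hc (rectHomKK_conj k hc h1 h2 h12) hk hG
  refine ⟨Φ, hΦ, ?_, ?_⟩
  · rw [rectQuadKK_eq_twists k (by omega) Φ hc h1 h2 h12]; exact hs
  · rw [rectQuadKK_eq_twists k (by omega) Φ hc h1 h2 h12]; exact hnc

/-- **The element-form criterion.**  For commuting independent `w₁, w₂` of odd order `k ≥ 3`, the rectangle
`Φ, Φ(cw₁), Φ(cw₂), Φ(w₁w₂)` exists `SumTwo` without a conjugate pair IFF `4k² ≤ |G|`. -/
theorem exists_rectQuad_kk_of_elems_iff [Fintype G] [DecidableEq G] {c : G} (hc : IsComplexConj c) {w₁ w₂ : G}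
    (h1 : orderOf w₁ = k) (h2 : orderOf w₂ = k) (h12 : w₁ * w₂ = w₂ * w₁) (hk : 3 ≤ k) (hodd : Odd k)
    (hind : ∀ a b : ℕ, w₁ ^ a * w₂ ^ b = 1 → w₁ ^ a = 1) :
    (∃ Φ : Finset G, IsCMType c Φ ∧ SumTwo (rectQuadKK Φ w₁ w₂ c) ∧
      ∀ i j : Fin 4, rectQuadKK Φ w₁ w₂ c j ≠ c • rectQuadKK Φ w₁ w₂ c i) ↔ 4 * (k * k) ≤ Fintype.card G := by
  constructor
  · rintro ⟨Φ, hΦ, hs, hnc⟩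
    rw [rectQuadKK_eq_twists k (by omega) Φ hc h1 h2 h12] at hs hnc
    exact four_mul_sq_le_card_of_rectQuad_kk k (rectHomKK k hc h1 h2 h12)
      (rectHomKK_injective k hc h1 h2 h12 hodd hind) hc (rectHomKK_conj k hc h1 h2 h12) hΦ hs hnc
  · exact exists_rectQuad_kk_of_elems k hc h1 h2 h12 hk hodd hind

end Elems

end HodgeRepro.CosetQuad
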